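import Summits.CriticalPhenomena.PercolationContinuityZ3.Theorems.PercNearOneGluingNoHeavyConstsClusterSquareUnlinked
import HarnessLib

/-!
# A doubly linked cluster realises a double clash: the converse of `…ClusterSquareUnlinked`

builds on p205010 (kernel theorem, internal audit signed; external expert review pending)

PAPER-2 track "percolation constants", part (ii), seat `prim-consts-1`, gen 17 (lane index
`run/shared/lean/prim/consts/CONSTANTS.md`, row A19; memo `FROM-prim-consts-1-g17-THREE-COPY-STRUCTURE.md` §2b).
Support file for the crux `NoHeavyLowerTail` (stmt-CriticalPhenomena-4575; `--supports`).  Theorems only; no sorries.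

`Consts.not_doubleClash_of_unlinked` shows that the no-double-clash hypothesis NDC(a; b, c) follows from the absence of a doubly
2-linked cluster.  Here is the converse (`Consts.doubleClash_of_linked`), for `H` the EXACT graph of positive pairs: if some `K ∋ a` with
`b, c ∉ K`, `H`-connected inside `K`, has vertices `y, y'`, each `H`-adjacent to `K`, with `H`-walks `y → b`, `y' → c` in `H − K`
sharing no vertex and `H`-walks `y → c`, `y' → b` in `H − K` sharing no vertex, then the configurations `ω :=` (all `H`-pairs inside `K`) ∪
(pairs of the first two walks) and `η :=` (pairs of the last two walks) form a double clash: `C_a(ω) = K`, `a ↮ b`, `a ↮ c`, `b ↮ c` in `ω`,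
`b ↮ c` in `η' = η ∖ (pairs meeting K) = η`, `y ∈ C_b(ω) ∩ C_c(η')`, `y' ∈ C_c(ω) ∩ C_b(η')`.  So **NDC(a; b, c) is EQUIVALENT to "no cluster
of `a` is doubly 2-linked to `{b, c}`"** (`Consts.noDoubleClash_iff_unlinked`) — the decidable criteria of this series are exactly ways of
certifying non-linkage, and cannot be sharpened beyond this.
Reference: N. Gladkov, arXiv:2408.08457v2 (2024), Def. 4.2, Example 2.5 (the clusters and their boundaries).
-/

noncomputable section

open Classical

namespace Summit.CriticalPhenomena.PercolationContinuityZ3.Theorems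

open MeasureTheory Finset Literature.Probability.LatticeModels Literature.Probability.Percolation
open Literature.Probability.Percolation.DecisionTree Literature.Probability.Percolation.BHK2006
open Literature.Probability.Percolation.TargetExploration Literature.Probability.Percolation.ClusterConditioning

namespace Consts

variable {V : Type*}

/-- A walk of `H` all of whose pairs are open in `ξ` joins its endpoints in `openGraph ξ`. [folklore] -/
theorem reachable_openGraph_of_walk {H : SimpleGraph V} {ξ : Set (Sym2 V)} {u v : V} (P : H.Walk u v)
    (hP : ∀ e ∈ P.edges, e ∈ ξ) : (openGraph ξ).Reachable u v := by
  induction P with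
  | nil => exact SimpleGraph.Reachable.refl _
  | @cons u x v h p ih =>
    have hux : (openGraph ξ).Adj u x := (openGraph_adj ξ u x).2 ⟨hP _ (by simp), h.ne⟩
    exact hux.reachable.trans (ih fun e he => hP e (by simp [he]))

/-- A set closed under open adjacency contains the open cluster of each of its vertices. [folklore] -/
theorem mem_of_reachable_of_closed {ξ : Set (Sym2 V)} (S : Set V) (hS : ∀ u v, u ∈ S → (openGraph ξ).Adj u v → v ∈ S)
    {s x : V} (hs : s ∈ S) (hx : (openGraph ξ).Reachable s x) : x ∈ S := by
  obtain ⟨W⟩ := hx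
  exact mem_of_openWalk_adm (openGraph ξ) S (fun _ => True) (fun u v hu huv _ => hS u v hu huv) (fun _ _ h => h) W hs
    fun _ _ => Or.inr trivial

/-- **A doubly 2-linked cluster realises a double clash** (converse of `Consts.not_doubleClash_of_unlinked`, for `H` the exact graph of
positive pairs).  See the module docstring for the construction. [folklore; Gladkov2024, Def. 4.2 / Ex. 2.5 for the objects] -/
theorem doubleClash_of_linked (H : SimpleGraph V) (w : Sym2 V → unitInterval) {a b c : V}
    (hH' : ∀ u v, H.Adj u v → (0 : ℝ) < w s(u, v)) (K : Set V) (y y' : V) (haK : a ∈ K) (hbK : b ∉ K) (hcK : c ∉ K)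
    (hKconn : ∀ x ∈ K, ∃ W : H.Walk a x, ∀ z ∈ W.support, z ∈ K)
    (hky : ∃ k, k ∈ K ∧ H.Adj k y) (hky' : ∃ k, k ∈ K ∧ H.Adj k y')
    (P₁ : H.Walk y b) (P₂ : H.Walk y' c) (hP₁ : ∀ x ∈ P₁.support, x ∉ K) (hP₂ : ∀ x ∈ P₂.support, x ∉ K)
    (hP : ∀ x, x ∈ P₁.support → x ∉ P₂.support)
    (Q₁ : H.Walk y c) (Q₂ : H.Walk y' b) (hQ₁ : ∀ x ∈ Q₁.support, x ∉ K) (hQ₂ : ∀ x ∈ Q₂.support, x ∉ K)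
    (hQ : ∀ x, x ∈ Q₁.support → x ∉ Q₂.support) :
    ∃ ω η : Set (Sym2 V), (∀ e ∈ ω, (0 : ℝ) < w e) ∧ (∀ e ∈ η, (0 : ℝ) < w e) ∧
      ¬ (openGraph ω).Reachable a b ∧ ¬ (openGraph ω).Reachable a c ∧ ¬ (openGraph ω).Reachable b c ∧
      ¬ (openGraph (η \ barOf {a} (setCl ω {a}))).Reachable b c ∧
      ((∃ y k : V, (openGraph ω).Reachable a k ∧ (0 : ℝ) < w s(k, y) ∧ (openGraph ω).Reachable b y ∧
          (openGraph (η \ barOf {a} (setCl ω {a}))).Reachable c y) ∧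
       (∃ y k : V, (openGraph ω).Reachable a k ∧ (0 : ℝ) < w s(k, y) ∧ (openGraph ω).Reachable c y ∧
          (openGraph (η \ barOf {a} (setCl ω {a}))).Reachable b y)) := by
  -- positivity of walk pairs
  have hpos : ∀ {u v : V} (P : H.Walk u v), ∀ e ∈ P.edges, (0 : ℝ) < w e := by
    intro u v P e he
    have he' := P.edges_subset_edgeSet he
    revert he'
    induction e using Sym2.ind with
    | h p q => intro hpq; exact hH' p q (by rwa [SimpleGraph.mem_edgeSet] at hpq)
  set ωK : Set (Sym2 V) := {e | ∃ u v, e = s(u, v) ∧ u ∈ K ∧ v ∈ K ∧ H.Adj u v} with hωK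
  set ω : Set (Sym2 V) := ωK ∪ ({e | e ∈ P₁.edges} ∪ {e | e ∈ P₂.edges}) with hωdef
  set η : Set (Sym2 V) := {e | e ∈ Q₁.edges} ∪ {e | e ∈ Q₂.edges} with hηdef
  have hωpos : ∀ e ∈ ω, (0 : ℝ) < w e := by
    rintro e (⟨u, v, rfl, -, -, huv⟩ | he | he)
    exacts [hH' u v huv, hpos P₁ e he, hpos P₂ e he]
  have hηpos : ∀ e ∈ η, (0 : ℝ) < w e := by
    rintro e (he | he)
    exacts [hpos Q₁ e he, hpos Q₂ e he]
  -- an `ω`-edge at a vertex: either inside `K`, or an edge of `P₁`, or of `P₂`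
  have hωadj : ∀ u v, (openGraph ω).Adj u v →
      (u ∈ K ∧ v ∈ K) ∨ (u ∈ P₁.support ∧ v ∈ P₁.support) ∨ (u ∈ P₂.support ∧ v ∈ P₂.support) := by
    intro u v huv
    have h := ((openGraph_adj ω u v).1 huv).1
    rcases h with ⟨u', v', he, hu', hv', -⟩ | he | he
    · left
      rcases Sym2.eq_iff.1 he with ⟨rfl, rfl⟩ | ⟨rfl, rfl⟩
      exacts [⟨hu', hv'⟩, ⟨hv', hu'⟩]
    · exact Or.inr (Or.inl ⟨P₁.fst_mem_support_of_mem_edges he, P₁.snd_mem_support_of_mem_edges he⟩)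
    · exact Or.inr (Or.inr ⟨P₂.fst_mem_support_of_mem_edges he, P₂.snd_mem_support_of_mem_edges he⟩)
  -- `K`, `P₁.support`, `P₂.support` are closed under `ω`-adjacency
  have hKcl : ∀ u v, u ∈ K → (openGraph ω).Adj u v → v ∈ K := by
    intro u v hu huv
    rcases hωadj u v huv with ⟨-, hv⟩ | ⟨hu1, -⟩ | ⟨hu2, -⟩
    exacts [hv, absurd hu (hP₁ u hu1), absurd hu (hP₂ u hu2)]
  have hP₁cl : ∀ u v, u ∈ P₁.support → (openGraph ω).Adj u v → v ∈ P₁.support := by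
    intro u v hu huv
    rcases hωadj u v huv with ⟨huK, -⟩ | ⟨-, hv⟩ | ⟨hu2, -⟩
    exacts [absurd huK (hP₁ u hu), hv, absurd hu2 (hP u hu)]
  have hP₂cl : ∀ u v, u ∈ P₂.support → (openGraph ω).Adj u v → v ∈ P₂.support := by
    intro u v hu huv
    rcases hωadj u v huv with ⟨huK, -⟩ | ⟨hu1, -⟩ | ⟨-, hv⟩
    exacts [absurd huK (hP₂ u hu), absurd hu (hP u hu1), hv]
  have hCa : ∀ x, (openGraph ω).Reachable a x → x ∈ K := fun x hx => mem_of_reachable_of_closed K hKcl haK hx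
  have hCb : ∀ x, (openGraph ω).Reachable b x → x ∈ P₁.support := fun x hx =>
    mem_of_reachable_of_closed _ hP₁cl P₁.end_mem_support hx
  -- reachability along the walks
  have hK_reach : ∀ x ∈ K, (openGraph ω).Reachable a x := by
    intro x hx
    obtain ⟨W, hW⟩ := hKconn x hx
    refine reachable_openGraph_of_walk W fun e he => Or.inl ?_
    revert he
    induction e using Sym2.ind with
    | h p q =>
      intro he
      exact ⟨p, q, rfl, hW p (W.fst_mem_support_of_mem_edges he), hW q (W.snd_mem_support_of_mem_edges he),
        by have := W.edges_subset_edgeSet he; rwa [SimpleGraph.mem_edgeSet] at this⟩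
  have hby : (openGraph ω).Reachable b y := (reachable_openGraph_of_walk P₁ fun e he => Or.inr (Or.inl he)).symm
  have hcy' : (openGraph ω).Reachable c y' := (reachable_openGraph_of_walk P₂ fun e he => Or.inr (Or.inr he)).symm
  -- the deleted pairs do not meet `η`: `η' = η`
  have hθ : η \ barOf {a} (setCl ω {a}) = η := by
    rw [barOf_setCl_singleton_eq_cutSet]
    ext e
    simp only [Set.mem_sdiff, and_iff_left_iff_imp]
    rintro he ⟨u, hue, hau⟩
    have huK : u ∈ K := hCa u hau
    rcases he with he | he
    · exact hQ₁ u (SimpleGraph.Walk.mem_support_of_mem_edges he hue) huK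
    · exact hQ₂ u (SimpleGraph.Walk.mem_support_of_mem_edges he hue) huK
  -- `η`-adjacency: an edge of `Q₁` or of `Q₂`; `Q₁.support` is closed
  have hQ₁cl : ∀ u v, u ∈ Q₁.support → (openGraph η).Adj u v → v ∈ Q₁.support := by
    intro u v hu huv
    rcases ((openGraph_adj η u v).1 huv).1 with he | he
    · exact Q₁.snd_mem_support_of_mem_edges he
    · exact absurd (Q₂.fst_mem_support_of_mem_edges he) (hQ u hu)
  have hCcη : ∀ x, (openGraph η).Reachable c x → x ∈ Q₁.support := fun x hx =>
    mem_of_reachable_of_closed _ hQ₁cl Q₁.end_mem_support hx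
  have hcyη : (openGraph η).Reachable c y := (reachable_openGraph_of_walk Q₁ fun e he => Or.inl he).symm
  have hby'η : (openGraph η).Reachable b y' := (reachable_openGraph_of_walk Q₂ fun e he => Or.inr he).symm
  obtain ⟨k, hkK, hky⟩ := hky
  obtain ⟨k', hkK', hky'⟩ := hky'
  refine ⟨ω, η, hωpos, hηpos, fun h => hbK (hCa b h), fun h => hcK (hCa c h),
    fun h => hP c (hCb c h) P₂.end_mem_support, ?_, ?_⟩
  · rw [hθ]; exact fun h => hQ b (hCcη b h.symm) Q₂.end_mem_support
  · rw [hθ]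
    exact ⟨⟨y, k, hK_reach k hkK, hH' k y hky, hby, hcyη⟩, ⟨y', k', hK_reach k' hkK', hH' k' y' hky', hcy', hby'η⟩⟩

/-- **NDC(a; b, c) ⟺ no cluster of `a` is doubly 2-linked to `{b, c}`**, for `H` the exact graph of positive pairs (the forward direction
is `Consts.not_doubleClash_of_unlinked`, with `K`-connectivity phrased by walks inside `K`). [folklore; input for Gladkov2024, Thm. 4.3] -/
theorem noDoubleClash_iff_unlinked (H : SimpleGraph V) (w : Sym2 V → unitInterval) {a b c : V}
    (hH : ∀ u v, u ≠ v → ((0 : ℝ) < w s(u, v) ↔ H.Adj u v)) :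
    (∀ ω η : Set (Sym2 V), (∀ e ∈ ω, (0 : ℝ) < w e) → (∀ e ∈ η, (0 : ℝ) < w e) →
      ¬ (openGraph ω).Reachable a b → ¬ (openGraph ω).Reachable a c →
      ¬ (openGraph ω).Reachable b c → ¬ (openGraph (η \ barOf {a} (setCl ω {a}))).Reachable b c →
      ¬ ((∃ y k : V, (openGraph ω).Reachable a k ∧ (0 : ℝ) < w s(k, y) ∧ (openGraph ω).Reachable b y ∧
            (openGraph (η \ barOf {a} (setCl ω {a}))).Reachable c y) ∧
         (∃ y k : V, (openGraph ω).Reachable a k ∧ (0 : ℝ) < w s(k, y) ∧ (openGraph ω).Reachable c y ∧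
            (openGraph (η \ barOf {a} (setCl ω {a}))).Reachable b y))) ↔
    (∀ (K : Set V) (y y' : V), a ∈ K → b ∉ K → c ∉ K → (∀ x ∈ K, ∃ W : H.Walk a x, ∀ z ∈ W.support, z ∈ K) →
      y ∉ K → y' ∉ K → (∃ k, k ∈ K ∧ H.Adj k y) → (∃ k, k ∈ K ∧ H.Adj k y') →
      ∀ (P₁ : H.Walk y b) (P₂ : H.Walk y' c) (Q₁ : H.Walk y c) (Q₂ : H.Walk y' b),
        (∀ x ∈ P₁.support, x ∉ K) → (∀ x ∈ P₂.support, x ∉ K) → (∀ x ∈ Q₁.support, x ∉ K) → (∀ x ∈ Q₂.support, x ∉ K) →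
        (∃ x, x ∈ P₁.support ∧ x ∈ P₂.support) ∨ (∃ x, x ∈ Q₁.support ∧ x ∈ Q₂.support)) := by
  constructor
  · intro hndc K y y' haK hbK hcK hKconn hyK hy'K hky hky' P₁ P₂ Q₁ Q₂ hP₁ hP₂ hQ₁ hQ₂
    by_contra hcon
    simp only [not_or, not_exists, not_and] at hcon
    obtain ⟨ω, η, hω, hη, hab, hac, hbc, hbc', hcl⟩ := doubleClash_of_linked H w (fun u v huv => (hH u v huv.ne).2 huv) K y y'
      haK hbK hcK hKconn hky hky' P₁ P₂ hP₁ hP₂ hcon.1 Q₁ Q₂ hQ₁ hQ₂ hcon.2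
    exact hndc ω η hω hη hab hac hbc hbc' hcl
  · intro hK ω η hω hη hab hac hbc hbc'
    refine not_doubleClash_of_unlinked H w (fun u v huv hw => (hH u v huv).1 hw) (fun K y y' haK hbK hcK hconn hyK hy'K hky hky'
      _ _ _ _ _ _ _ => ?_) hω hη hab hac hbc hbc'
    -- connectivity of `K` by walks inside `K`, from the closure certificate
    have hKconn : ∀ x ∈ K, ∃ W : H.Walk a x, ∀ z ∈ W.support, z ∈ K := by
      have hT := hconn {x | ∃ W : H.Walk a x, ∀ z ∈ W.support, z ∈ K} ⟨SimpleGraph.Walk.nil, by simpa using haK⟩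
        (by
          rintro u x ⟨W, hW⟩ hux hxK
          refine ⟨W.append (SimpleGraph.Walk.cons hux SimpleGraph.Walk.nil), fun z hz => ?_⟩
          rw [SimpleGraph.Walk.support_append] at hz
          simp only [SimpleGraph.Walk.support_cons, SimpleGraph.Walk.support_nil, List.tail_cons, List.mem_append,
            List.mem_singleton] at hz
          rcases hz with hz | rfl
          exacts [hW z hz, hxK])
      exact fun x hx => hT hx
    by_cases h : ∀ (P₁ : H.Walk y b) (P₂ : H.Walk y' c), (∀ x ∈ P₁.support, x ∉ K) → (∀ x ∈ P₂.support, x ∉ K) →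
        ∃ x, x ∈ P₁.support ∧ x ∈ P₂.support
    · exact Or.inl h
    · right
      intro Q₁ Q₂ hQ₁ hQ₂
      simp only [not_forall, not_exists, not_and] at h
      obtain ⟨P₁, P₂, hP₁, hP₂, hdis⟩ := h
      rcases hK K y y' haK hbK hcK hKconn hyK hy'K hky hky' P₁ P₂ Q₁ Q₂ hP₁ hP₂ hQ₁ hQ₂ with ⟨x, h1, h2⟩ | hx
      · exact absurd h2 (hdis x h1)
      · exact hx

end Consts

end Summit.CriticalPhenomena.PercolationContinuityZ3.Theorems
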